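import Mathlib
import Summits.NavierStokesRegularity.NavierStokesRegularity.Theorems.TaoLadderRungTwoBreakOneShiftWindowKrawczykDeriv
import HarnessLib

/-!
# The one-shift window system, VIII: the derivative bound of (K1) from the ROW SUMS of a coordinate
# (interval) matrix (cell harvest/h2-tao-ladder, seat p2; rung1/RUNG1-P2G11-REPORT.md §48–§50;
# support for K1(1) = `NoSurvivingDSSOne`, stmt-NavierStokesRegularity-20205)

MODEL lattice ODEs only (Tao 2016 §4 normal form on Tao's shift set `S`); nothing here is a statement about
the Navier–Stokes equations; no item is closed; nothing numerical is proved.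

Part VII (…OneShiftWindowKrawczykDeriv, `K1_of_fderiv`) reduced the contraction clause (K1) of the Krawczyk
step to: the scaled Krawczyk map `ξ ↦ ξ − P(ξ, t)` has, within the closed unit ball of the window space
`WState × ℝ` (sup norms), a derivative `L t ξ` of OPERATOR NORM `≤ Z`. What a replay actually computes is an
INTERVAL MATRIX `[R] = I − S⁻¹·C·[DG]·S` whose `(row, column)` entry encloses the corresponding coordinate of
`L t ξ` for every admissible `(t, ξ)`, and the number `max_row Σ_col mag [R]_{row,col}`. This file is the
(elementary, finite-dimensional) link: for the sup norm on `WState × ℝ = ℝ^{m×W} × ℝ` the operator norm of a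
continuous linear map is at most its largest absolute ROW SUM in the coordinate basis
(`opNorm_le_of_rowSum_le`), hence at most the largest row sum of entrywise magnitude bounds
(`opNorm_le_of_entryBound`), and (K1) follows from row-sum data (`K1_of_rowSum`). The PHASE-A finding of
RUNG1-P2G11-REPORT §48 (the row of record tolerates `[DG]` of absolute scaled width `1e-6`, i.e. a frameless
low-order C¹ enclosure) is what makes this the operative form of (K1) for the kernel replay.

* `eW j l`, `eT` — the coordinate vectors of `WState × ℝ`; `sum_coord_smul` — every vector is the finite
  coordinate combination;
* `rowSumW L i k`, `rowSumT L` — absolute row sums of the coordinate matrix of `L`;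
* `opNorm_le_of_rowSum_le`, `opNorm_le_of_entryBound`, `K1_of_rowSum`.
-/

noncomputable section

-- the sub-problem namespace repeats the summit name by design (D-0017)
set_option linter.dupNamespace false

namespace Summit.NavierStokesRegularity.NavierStokesRegularity.Theorems

namespace DSSOneShift

open Set Metric Literature.Analysis.FluidPDE Literature.Analysis.FluidPDE.TaoCascade CertificateGlueOn

variable {m : ℕ}

namespace OneShiftFrame

variable (F : OneShiftFrame m)

/-- The coordinate vector of the window component `(j, l)` of `WState × ℝ`. [folklore] -/
def eW (j : Fin m) (l : Fin F.W) : F.WState × ℝ := (Pi.single j (Pi.single l 1), 0)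

/-- The coordinate vector of the flight-time component of `WState × ℝ`. [folklore] -/
def eT : F.WState × ℝ := (0, 1)

/-- Coordinates of `eW`. [folklore] -/
theorem eW_fst_apply (j : Fin m) (l : Fin F.W) (i : Fin m) (k : Fin F.W) :
    (F.eW j l).1 i k = if i = j ∧ k = l then 1 else 0 := by
  simp only [eW, Pi.single_apply]
  by_cases h : i = j
  · subst h; by_cases h' : k = l <;> simp [h']
  · simp [h]

/-- Every vector of `WState × ℝ` is the finite combination of the coordinate vectors with its coordinates.
[folklore] -/
theorem sum_coord_smul (x : F.WState × ℝ) :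
    (∑ j, ∑ l, x.1 j l • F.eW j l) + x.2 • F.eT = x := by
  ext i k
  · simp only [Prod.fst_add, Prod.fst_sum, Prod.smul_fst, Finset.sum_apply, Pi.smul_apply, eW_fst_apply,
      smul_eq_mul, mul_ite, mul_one, mul_zero, eT, smul_zero, add_zero]
    rw [Finset.sum_eq_single i (fun j _ hj => by simp [Ne.symm hj]) (fun h => (h (Finset.mem_univ i)).elim)]
    simp
  · simp [eW, eT, Prod.snd_sum]

/-- The absolute row sum of the coordinate matrix of `L` in the window row `(i, k)`. [folklore] -/
def rowSumW (L : (F.WState × ℝ) →L[ℝ] (F.WState × ℝ)) (i : Fin m) (k : Fin F.W) : ℝ :=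
  (∑ j, ∑ l, |(L (F.eW j l)).1 i k|) + |(L F.eT).1 i k|

/-- The absolute row sum of the coordinate matrix of `L` in the flight-time row. [folklore] -/
def rowSumT (L : (F.WState × ℝ) →L[ℝ] (F.WState × ℝ)) : ℝ :=
  (∑ j, ∑ l, |(L (F.eW j l)).2|) + |(L F.eT).2|

/-- `L x` in coordinates (window rows). [folklore] -/
theorem apply_fst_eq (L : (F.WState × ℝ) →L[ℝ] (F.WState × ℝ)) (x : F.WState × ℝ) (i : Fin m) (k : Fin F.W) :
    (L x).1 i k = (∑ j, ∑ l, x.1 j l * (L (F.eW j l)).1 i k) + x.2 * (L F.eT).1 i k := by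
  conv_lhs => rw [← F.sum_coord_smul x]
  simp only [map_add, map_sum, map_smul, Prod.fst_add, Prod.fst_sum, Prod.smul_fst, Pi.add_apply,
    Finset.sum_apply, Pi.smul_apply, smul_eq_mul]

/-- `L x` in coordinates (flight-time row). [folklore] -/
theorem apply_snd_eq (L : (F.WState × ℝ) →L[ℝ] (F.WState × ℝ)) (x : F.WState × ℝ) :
    (L x).2 = (∑ j, ∑ l, x.1 j l * (L (F.eW j l)).2) + x.2 * (L F.eT).2 := by
  conv_lhs => rw [← F.sum_coord_smul x]
  simp only [map_add, map_sum, map_smul, Prod.snd_add, Prod.snd_sum, Prod.smul_snd, smul_eq_mul]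

/-- Coordinates are bounded by the sup norm. [folklore] -/
theorem abs_fst_apply_le_norm (x : F.WState × ℝ) (j : Fin m) (l : Fin F.W) : |x.1 j l| ≤ ‖x‖ := by
  rw [← Real.norm_eq_abs]
  exact ((norm_le_pi_norm (x.1 j) l).trans (norm_le_pi_norm x.1 j)).trans (norm_fst_le x)

/-- Coordinates are bounded by the sup norm. [folklore] -/
theorem abs_snd_le_norm (x : F.WState × ℝ) : |x.2| ≤ ‖x‖ := by
  rw [← Real.norm_eq_abs]; exact norm_snd_le x

/-- **Operator norm ≤ largest absolute row sum** (sup norms on `WState × ℝ`). [folklore; cite: cell vocabulary, harvest/h2-tao-ladder rung1/STAGE2-LEMMA.md §3 (‖I − C·DG(X)‖_∞ = max row sum)] -/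
theorem opNorm_le_of_rowSum_le (L : (F.WState × ℝ) →L[ℝ] (F.WState × ℝ)) {Z : ℝ}
    (h1 : ∀ i k, F.rowSumW L i k ≤ Z) (h2 : F.rowSumT L ≤ Z) : ‖L‖ ≤ Z := by
  have hZ : 0 ≤ Z := le_trans (by unfold rowSumT; positivity) h2
  refine ContinuousLinearMap.opNorm_le_bound L hZ fun x => ?_
  have hx1 : ∀ j l, |x.1 j l| ≤ ‖x‖ := F.abs_fst_apply_le_norm x
  have hx2 : |x.2| ≤ ‖x‖ := F.abs_snd_le_norm x
  -- window rows
  have hW : ∀ i k, |(L x).1 i k| ≤ Z * ‖x‖ := by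
    intro i k
    rw [F.apply_fst_eq L x i k]
    calc |(∑ j, ∑ l, x.1 j l * (L (F.eW j l)).1 i k) + x.2 * (L F.eT).1 i k|
        ≤ (∑ j, ∑ l, |x.1 j l * (L (F.eW j l)).1 i k|) + |x.2 * (L F.eT).1 i k| := by
          refine (abs_add_le _ _).trans (add_le_add ?_ le_rfl)
          exact (Finset.abs_sum_le_sum_abs _ _).trans (Finset.sum_le_sum fun j _ => Finset.abs_sum_le_sum_abs _ _)
      _ ≤ (∑ j, ∑ l, ‖x‖ * |(L (F.eW j l)).1 i k|) + ‖x‖ * |(L F.eT).1 i k| := by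
          gcongr with j _ l _
          · rw [abs_mul]; exact mul_le_mul_of_nonneg_right (hx1 j l) (abs_nonneg _)
          · rw [abs_mul]; exact mul_le_mul_of_nonneg_right hx2 (abs_nonneg _)
      _ = ‖x‖ * F.rowSumW L i k := by
          simp only [rowSumW, Finset.mul_sum, mul_add]
      _ ≤ ‖x‖ * Z := mul_le_mul_of_nonneg_left (h1 i k) (norm_nonneg _)
      _ = Z * ‖x‖ := mul_comm _ _
  -- flight-time row
  have hT : |(L x).2| ≤ Z * ‖x‖ := by
    rw [F.apply_snd_eq L x]
    calc |(∑ j, ∑ l, x.1 j l * (L (F.eW j l)).2) + x.2 * (L F.eT).2|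
        ≤ (∑ j, ∑ l, |x.1 j l * (L (F.eW j l)).2|) + |x.2 * (L F.eT).2| := by
          refine (abs_add_le _ _).trans (add_le_add ?_ le_rfl)
          exact (Finset.abs_sum_le_sum_abs _ _).trans (Finset.sum_le_sum fun j _ => Finset.abs_sum_le_sum_abs _ _)
      _ ≤ (∑ j, ∑ l, ‖x‖ * |(L (F.eW j l)).2|) + ‖x‖ * |(L F.eT).2| := by
          gcongr with j _ l _
          · rw [abs_mul]; exact mul_le_mul_of_nonneg_right (hx1 j l) (abs_nonneg _)
          · rw [abs_mul]; exact mul_le_mul_of_nonneg_right hx2 (abs_nonneg _)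
      _ = ‖x‖ * F.rowSumT L := by
          simp only [rowSumT, Finset.mul_sum, mul_add]
      _ ≤ ‖x‖ * Z := mul_le_mul_of_nonneg_left h2 (norm_nonneg _)
      _ = Z * ‖x‖ := mul_comm _ _
  -- assemble the sup norm of `L x`
  rw [Prod.norm_def]
  refine max_le ?_ ?_
  · refine (pi_norm_le_iff_of_nonneg (by positivity)).2 fun i => ?_
    refine (pi_norm_le_iff_of_nonneg (by positivity)).2 fun k => ?_
    rw [Real.norm_eq_abs]; exact hW i k
  · rw [Real.norm_eq_abs]; exact hT

/-- **Operator norm from ENTRYWISE MAGNITUDE BOUNDS** (what an interval matrix `[R] ∋ R` delivers: `|R_{rc}| ≤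
mag [R]_{rc}`): if `|(L e_col)_row| ≤ M row col` for all coordinates and every row sum of `M` is `≤ Z`, then
`‖L‖ ≤ Z`. Rows/columns are indexed by `Option (Fin m × Fin W)` (`none` = the flight-time coordinate).
[folklore; cite: cell vocabulary, harvest/h2-tao-ladder rung1/STAGE2-LEMMA.md §3, rung1/RUNG1-P2G11-REPORT.md §48] -/
theorem opNorm_le_of_entryBound (L : (F.WState × ℝ) →L[ℝ] (F.WState × ℝ))
    (M : Option (Fin m × Fin F.W) → Option (Fin m × Fin F.W) → ℝ) {Z : ℝ}
    (hWW : ∀ i k j l, |(L (F.eW j l)).1 i k| ≤ M (some (i, k)) (some (j, l)))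
    (hWT : ∀ i k, |(L F.eT).1 i k| ≤ M (some (i, k)) none)
    (hTW : ∀ j l, |(L (F.eW j l)).2| ≤ M none (some (j, l)))
    (hTT : |(L F.eT).2| ≤ M none none)
    (hrowW : ∀ i k, (∑ j, ∑ l, M (some (i, k)) (some (j, l))) + M (some (i, k)) none ≤ Z)
    (hrowT : (∑ j, ∑ l, M none (some (j, l))) + M none none ≤ Z) : ‖L‖ ≤ Z := by
  refine F.opNorm_le_of_rowSum_le L (fun i k => le_trans ?_ (hrowW i k)) (le_trans ?_ hrowT)
  · unfold rowSumW
    exact add_le_add (Finset.sum_le_sum fun j _ => Finset.sum_le_sum fun l _ => hWW i k j l) (hWT i k)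
  · unfold rowSumT
    exact add_le_add (Finset.sum_le_sum fun j _ => Finset.sum_le_sum fun l _ => hTW j l) hTT

/-- An interval enclosure `lo ≤ a ≤ hi` bounds `|a|` by the magnitude `max |lo| |hi|`. [folklore] -/
theorem abs_le_mag_of_mem {a lo hi : ℝ} (h1 : lo ≤ a) (h2 : a ≤ hi) : |a| ≤ max |lo| |hi| := by
  rcases le_total 0 a with ha | ha
  · exact (abs_of_nonneg ha).symm ▸ (h2.trans (le_abs_self hi)).trans (le_max_right _ _)
  · rw [abs_of_nonpos ha]
    exact ((neg_le_neg h1).trans (neg_le_abs lo)).trans (le_max_left _ _)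

/-- **(K1) FROM ROW-SUM DATA.** If, for every tail part of an admissible point and every `ξ` in the closed
unit ball, the scaled Krawczyk map has within the ball a derivative `L t ξ` whose coordinate matrix has all
absolute row sums `≤ Z` (in a replay: `L t ξ ∈ [R] = I − S⁻¹ C [DG] S` entrywise and
`max_row Σ_col mag [R] ≤ Z`), then (K1) holds in the form consumed by `krawczyk_winIn` / `krawczyk_wedge`.
[cite: Tao2016AveragedNS, §5.3; cell vocabulary, harvest/h2-tao-ladder rung1/STAGE2-LEMMA.md §2–§3, rung1/RUNG1-P2G11-REPORT.md §48–§50] -/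
theorem K1_of_rowSum {ε₀ : ℝ} {α : Fin m → Fin m → Fin m → ℤ × ℤ × ℤ → ℝ} (C : F.WState × ℝ → F.WState × ℝ)
    (R : ℤ → ℝ) {Z : ℝ} {L : lp (fun _ : F.TailIdx => ℝ) ⊤ → F.WState × ℝ → (F.WState × ℝ) →L[ℝ] (F.WState × ℝ)}
    (hderiv : ∀ u, F.AdmLip R u → ∀ ξ ∈ closedBall (0 : F.WState × ℝ) 1,
      HasFDerivWithinAt (F.krawczykMap ε₀ α C u.2.2) (L u.2.2 ξ) (closedBall (0 : F.WState × ℝ) 1) ξ)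
    (hrowW : ∀ u, F.AdmLip R u → ∀ ξ ∈ closedBall (0 : F.WState × ℝ) 1, ∀ i k, F.rowSumW (L u.2.2 ξ) i k ≤ Z)
    (hrowT : ∀ u, F.AdmLip R u → ∀ ξ ∈ closedBall (0 : F.WState × ℝ) 1, F.rowSumT (L u.2.2 ξ) ≤ Z) :
    ∀ u v, F.AdmLip R u → F.AdmLip R v → u.2.2 = v.2.2 →
      (∀ i j, |(u.1 i j - v.1 i j) -
        ((F.precondResidual ε₀ α C u).1 i j - (F.precondResidual ε₀ α C v).1 i j)| ≤ Z * dist u v) ∧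
      |(u.2.1 - v.2.1) - ((F.precondResidual ε₀ α C u).2 - (F.precondResidual ε₀ α C v).2)| ≤ Z * dist u v :=
  F.K1_of_fderiv C R hderiv fun u hu ξ hξ =>
    F.opNorm_le_of_rowSum_le (L u.2.2 ξ) (hrowW u hu ξ hξ) (hrowT u hu ξ hξ)

end OneShiftFrame

end DSSOneShift

end Summit.NavierStokesRegularity.NavierStokesRegularity.Theorems
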